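import Summits.FinalStateConjecture.FinalStateConjecture.Theorems.EIHFluxBalanceInertialRecessionRechartAssembly
import Summits.FinalStateConjecture.FinalStateConjecture.Theorems.EIHFluxBalanceInertialRecessionRechartTransfer2
import Summits.FinalStateConjecture.FinalStateConjecture.Theorems.EIHFluxBalanceInertialRecessionRechartStatic

/-!
# Route EIHFluxBalance — `InertialRecession`, re-charting: the `a = 0` decomposition from the
# packages WITHOUT the loitering clause

Helper file for the crux `stmt-FinalStateConjecture-10166`
(`Summit.FinalStateConjecture.FinalStateConjecture.Theses.EIHFluxBalance.InertialRecession`),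
stub `stub_rechart` of line `sublinear-is-free-clean-window-charges`.

`exists_finalStateDecomposition_spinZero_of_packages₂`: the statement of
`exists_finalStateDecomposition_spinZero_of_packages` (`…RechartAssembly`) with the loitering
hypothesis (Hov) REPLACED by eventual lab-time causality of the chart (the registered hypothesis of
`stub_rechart`) and continuity of the frames; the transfer is
`exterior_subset_certified_union_causalPast₂` (`…RechartTransfer2`), its extra inputs being
discharged from `…RechartStatic` and `…RechartDictionary` (`Rzᵢ = r₊ᵢ + 1`, `δ = 1`). [folklore]
-/

noncomputable section

set_option linter.dupNamespace false

open scoped Topology ContDiff InnerProductSpace Manifold ENNReal BigOperators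
open Filter Set Metric Topology Function TopologicalSpace Literature.Geometry.Lorentzian

namespace Summit.FinalStateConjecture.FinalStateConjecture.Theorems

/-- Registered one-line form (stub `le_of_le_apply_of_deriv_pos_rechart` of the crux item) of
`le_of_le_apply_of_deriv_pos`. [folklore] -/
theorem le_of_le_apply_of_deriv_pos_rechart : ∀ {θ : ℝ → ℝ} {T s₀ : ℝ}, (∀ s, 0 < deriv θ s) → (∀ s, T + 1 ≤ s → θ s = s) → T + 1 ≤ θ s₀ → T + 1 ≤ s₀ :=
  fun hθ' hθid h ↦ le_of_le_apply_of_deriv_pos hθ' hθid h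

/-! ### The re-charted decomposition from the packages, without loitering -/

section Assembly

variable {X : Type} [TopologicalSpace X] [ChartedSpace E3 X] [IsManifold (𝓡 3) ∞ X]
  [ConnectedSpace X] {D : InitialDataSet (𝓡 3) X}

-- long bookkeeping proof
set_option maxHeartbeats 1600000 in
/-- **The `a = 0` re-charted decomposition from the packages, without the loitering clause.**
See the module docstring. [folklore] -/
theorem exists_finalStateDecomposition_spinZero_of_packages₂ (𝒟 : VacuumCauchyDevelopment D)
    {N : ℕ} (i₀ : Fin N) (M rin : Fin N → ℝ) (hM : ∀ i, 0 < M i)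
    (hrin : ∀ j, rin j < Kerr.rPlus (M j) 0) (Λ : Fin N → ℝ → lorentzGroup)
    (ξ v : Fin N → ℝ → E3)
    (hfut : ∀ j t, 0 < (((Λ j t : E4 ≃L[ℝ] E4) (E4.basisVector 0)) 0))
    (hvΛ : ∀ j t, E4.spatial ((Λ j t : E4 ≃L[ℝ] E4) (E4.basisVector 0)) =
      (((Λ j t : E4 ≃L[ℝ] E4) (E4.basisVector 0)) 0) • v j t)
    (U : Opens E4) (Φ : U → 𝒟.carrier) (hΦ : ContMDiff 𝓘(ℝ, E4) (𝓡 4) ∞ Φ)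
    (hdev : Tendsto (fun t ↦ 𝒟.toSpacetime.deviationCk ⟨U, fun x ↦ Minkowski.bilin +
      ∑ j, (boostedKerrBilin (Λ j (x 0)) (E4.ofTimeSpace (x 0) (ξ j (x 0))) (M j) 0 x -
        Minkowski.bilin), fun x ↦ x 0, E4.spatialNorm⟩ Φ 2 t) atTop (𝓝 0))
    {κ₀ : ℝ} (hκ₀ : κ₀ < 1) (hvs : ∀ j t, ‖v j t‖ ≤ κ₀)
    (hv : ∀ j, ContDiff ℝ ∞ (v j)) (hξ : ∀ j, ContDiff ℝ ∞ (ξ j)) {Γ T₀ : ℝ}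
    (hvb : ∀ j t, T₀ ≤ t → ∀ l, 1 ≤ l → l ≤ 2 → ‖iteratedDeriv l (v j) t‖ ≤ Γ)
    (hξb : ∀ j t, T₀ ≤ t → ∀ l, 1 ≤ l → l ≤ 2 → ‖iteratedDeriv l (ξ j) t‖ ≤ Γ)
    (hsep : ∀ i j, i ≠ j → Tendsto (fun t ↦ ‖ξ i t - ξ j t‖) atTop atTop)
    (V : Fin N → E3) (hV1 : ∀ i, ‖V i‖ < 1) (hvV : ∀ i, Tendsto (v i) atTop (𝓝 (V i)))
    (hξV : ∀ i, Tendsto (deriv (ξ i)) atTop (𝓝 (V i)))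
    (hξ0 : ∀ i l, 2 ≤ l → l ≤ 3 → Tendsto (fun t ↦ iteratedDeriv l (ξ i) t) atTop (𝓝 0))
    (hv0 : ∀ i l, 1 ≤ l → l ≤ 3 → Tendsto (fun t ↦ iteratedDeriv l (v i) t) atTop (𝓝 0))
    (hces : ∀ i, Tendsto (fun t : ℝ ↦ t⁻¹ • ξ i t) atTop (𝓝 (V i)))
    {τ₀ : ℝ}
    (hU : {x : E4 | τ₀ < x 0 ∧ ∀ j, rin j < Kerr.radius 0 (poincareInv (Λ j (x 0))
      (E4.ofTimeSpace (x 0) (ξ j (x 0))) x)} ⊆ (U : Set E4))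
    (hembΦ : IsOpenEmbedding (({x : U | τ₀ < x.1 0} : Set U).restrict Φ))
    (O : Set 𝒟.carrier)
    (hO : O = 𝒟.metric.causalFuture 𝒟.timeOrientation (range 𝒟.embed) ∩
      𝒟.metric.chronologicalPast 𝒟.timeOrientation (Φ '' {x : U | τ₀ < x.1 0 ∧ ∀ j,
        Kerr.rPlus (M j) 0 < Kerr.radius 0 (poincareInv (Λ j (x.1 0))
          (E4.ofTimeSpace (x.1 0) (ξ j (x.1 0))) x.1)}))
    (himO : Φ '' {x : U | τ₀ < x.1 0 ∧ ∀ j, Kerr.rPlus (M j) 0 < Kerr.radius 0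
      (poincareInv (Λ j (x.1 0)) (E4.ofTimeSpace (x.1 0) (ξ j (x.1 0))) x.1)} ⊆ O)
    (hexh : ∀ t₁ : ℝ, τ₀ < t₁ → O \ Φ '' {x : U | t₁ < x.1 0 ∧ ∀ j, Kerr.rPlus (M j) 0 <
      Kerr.radius 0 (poincareInv (Λ j (x.1 0)) (E4.ofTimeSpace (x.1 0) (ξ j (x.1 0))) x.1)} ⊆
      𝒟.metric.causalPast 𝒟.timeOrientation (Φ '' {x : U | x.1 0 = t₁ ∧ ∀ j, Kerr.rPlus (M j) 0 <
        Kerr.radius 0 (poincareInv (Λ j (x.1 0)) (E4.ofTimeSpace (x.1 0) (ξ j (x.1 0))) x.1)}))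
    -- (Ofut): the lab chart is future-oriented on the late guaranteed region
    {TO : ℝ}
    (hOfut : ∀ x : U, TO < x.1 0 → (∀ j, rin j < Kerr.radius 0 (poincareInv (Λ j (x.1 0))
      (E4.ofTimeSpace (x.1 0) (ξ j (x.1 0))) x.1)) → ∀ w : E4, 0 < w 0 →
      𝒟.metric.val (Φ x) (mfderiv 𝓘(ℝ, E4) (𝓡 4) Φ x w) (mfderiv 𝓘(ℝ, E4) (𝓡 4) Φ x w) < 0 →
        𝒟.timeOrientation.IsFutureDirected (mfderiv 𝓘(ℝ, E4) (𝓡 4) Φ x w))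
    -- continuity of the frames, eventual lab-time causality of the chart
    (hΛc : ∀ j, Continuous fun t ↦ ((Λ j t : E4 ≃L[ℝ] E4) : E4 →L[ℝ] E4)) {τT : ℝ}
    (hT : ∀ x y : U, (τT < x.1 0 ∧ ∀ j, rin j < Kerr.radius 0 (poincareInv (Λ j (x.1 0))
      (E4.ofTimeSpace (x.1 0) (ξ j (x.1 0))) x.1)) → (τT < y.1 0 ∧ ∀ j, rin j <
      Kerr.radius 0 (poincareInv (Λ j (y.1 0)) (E4.ofTimeSpace (y.1 0) (ξ j (y.1 0))) y.1)) →
      Φ y ∈ 𝒟.metric.causalFuture 𝒟.timeOrientation {Φ x} → x.1 0 ≤ y.1 0) :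
    ∃ (O' : Set 𝒟.carrier) (d : FinalStateDecomposition 𝒟.toSpacetime O' 2),
      (∀ i, Kerr.IsSubextremal (d.mass i) (d.spin i)) ∧
        O' = Summit.FinalStateConjecture.exteriorOf 𝒟.toCauchyDevelopment d.charted ∧
          Summit.FinalStateConjecture.HasExhaustiveCharts d := by
  classical
  -- ### notation
  set rp : Fin N → U → ℝ := fun j x ↦ Kerr.radius 0 (poincareInv (Λ j (x.1 0))
    (E4.ofTimeSpace (x.1 0) (ξ j (x.1 0))) x.1) with hrp
  set Pext : U → Prop := fun x ↦ ∀ j, Kerr.rPlus (M j) 0 < rp j x with hPext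
  set γ₀ : ℝ := (Real.sqrt (1 - κ₀ ^ 2))⁻¹ with hγ₀
  have hκ : 0 ≤ κ₀ := (norm_nonneg (v i₀ 0)).trans (hvs i₀ 0)
  have hγ₀1 : 1 ≤ γ₀ := one_le_inv_sqrt_one_sub_sq hκ hκ₀
  have hv1 : ∀ j t, ‖v j t‖ < 1 := fun j t ↦ (hvs j t).trans_lt hκ₀
  have hrp0 : ∀ j, 0 < Kerr.rPlus (M j) 0 := fun j ↦ by rw [Kerr.rPlus_zero_right (hM j).le]; linarith [hM j]
  -- ### the hole packages, after `τ* = max τ₀ TO`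
  set τs : ℝ := max τ₀ TO with hτs
  have hUs : {x : E4 | τs < x 0 ∧ ∀ j, rin j < Kerr.radius 0 (poincareInv (Λ j (x 0))
      (E4.ofTimeSpace (x 0) (ξ j (x 0))) x)} ⊆ (U : Set E4) := fun x hx ↦
    hU ⟨(le_max_left _ _).trans_lt hx.1, hx.2⟩
  have hsep' : ∀ i, ∀ j ≠ i, Tendsto (fun t ↦ ‖ξ i t - ξ j t‖) atTop atTop :=
    fun i j hj ↦ hsep i j (Ne.symm hj)
  choose T ρ θ Rd A hAU hpk using fun i ↦ exists_holePackage_diag 𝒟.toSpacetime i M Λ ξ v hfut hvΛ U Φ hΦ hdev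
    hκ₀ hvs hv hξ hvb hξb (hsep' i) (hM i) (hV1 i) (hvV i) (hξV i) (hξ0 i) (hv0 i) hrin hUs
  have hτT : ∀ i, τs ≤ T i := fun i ↦ (hpk i).1
  have hA : ∀ i, ContDiff ℝ ∞ (A i) := fun i ↦ (hpk i).2.1
  have hAemb : ∀ i, IsOpenEmbedding (A i) := fun i ↦ (hpk i).2.2.1
  have hρc : ∀ i, Continuous (ρ i) := fun i ↦ (hpk i).2.2.2.1
  have hρt : ∀ i, Tendsto (ρ i) atTop atTop := fun i ↦ (hpk i).2.2.2.2.1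
  have hAT : ∀ i (x : E4), T i < A i x 0 := fun i ↦ (hpk i).2.2.2.2.2.2.1
  have himg := fun i ↦ (hpk i).2.2.2.2.2.2.2.1
  have hhon := fun i ↦ (hpk i).2.2.2.2.2.2.2.2.1
  have hcovA := fun i ↦ (hpk i).2.2.2.2.2.2.2.2.2.1
  have hrad2 := fun i ↦ (hpk i).2.2.2.2.2.2.2.2.2.2.1
  have hAθ : ∀ i (x : E4), A i x 0 = θ i (x 0) := fun i ↦ (hpk i).2.2.2.2.2.2.2.2.2.2.2.1
  have hθid : ∀ i s, T i + 1 ≤ s → θ i s = s := fun i ↦ (hpk i).2.2.2.2.2.2.2.2.2.2.2.2.1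
  have hθ' : ∀ i s, 0 < deriv (θ i) s := fun i ↦ (hpk i).2.2.2.2.2.2.2.2.2.2.2.2.2.1
  have hDA : ∀ i (x w : E4), (fderiv ℝ (A i) x w) 0 = deriv (θ i) (x 0) * w 0 :=
    fun i ↦ (hpk i).2.2.2.2.2.2.2.2.2.2.2.2.2.2.1
  have hconvR := fun i ↦ (hpk i).2.2.2.2.2.2.2.2.2.2.2.2.2.2.2.1
  have hRd0 : ∀ i t, 0 ≤ Rd i t := fun i ↦ (hpk i).2.2.2.2.2.2.2.2.2.2.2.2.2.2.2.2.1
  have hRdt : ∀ i, Tendsto (Rd i) atTop atTop := fun i ↦ (hpk i).2.2.2.2.2.2.2.2.2.2.2.2.2.2.2.2.2.1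
  have hRdc := fun i ↦ (hpk i).2.2.2.2.2.2.2.2.2.2.2.2.2.2.2.2.2.2
  have hτ0T : ∀ i, τ₀ ≤ T i := fun i ↦ (le_max_left _ _).trans (hτT i)
  have hTOT : ∀ i, TO ≤ T i := fun i ↦ (le_max_right _ _).trans (hτT i)
  -- painted radii at the lab points of the hole charts
  have hPextA : ∀ (i : Fin N)
      (y : (boostedKerrBackground (Lorentz.boost (V i) (hV1 i)) 0 (M i) 0).domain),
      Pext ⟨A i y.1, hAU i y.1 y.2⟩ := by
    intro i y
    have hy := y.2
    change y.1 ∈ boostedKerrExterior (Lorentz.boost (V i) (hV1 i)) 0 (M i) 0 at hy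
    rw [mem_boostedKerrExterior, Kerr.mem_exterior, poincareInv_zero, Kerr.radius_zero_left,
      max_eq_left (hrp0 i).le] at hy
    exact himg i y.1 hy
  have hQA : ∀ (i : Fin N)
      (y : (boostedKerrBackground (Lorentz.boost (V i) (hV1 i)) 0 (M i) 0).domain),
      TO < A i y.1 0 ∧ ∀ j, rin j < rp j ⟨A i y.1, hAU i y.1 y.2⟩ := fun i y ↦
    ⟨(hTOT i).trans_lt (hAT i y.1), fun j ↦ (hrin j).trans (hPextA i y j)⟩
  -- ### zone radii and meshed radii
  set Rz : Fin N → ℝ := fun i ↦ Kerr.rPlus (M i) 0 + 1 with hRz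
  have hγV : ∀ i, 0 < Lorentz.gamma (V i) := fun i ↦ Lorentz.gamma_pos (hV1 i)
  obtain ⟨R, R', hRm, hRle, hRt, hR'c, hR'0, hR't, hR'd, Tm, hTm⟩ :=
    exists_meshed_radii i₀ Rd ρ hRd0 hRdt hρc hρt (C := γ₀ ^ 2) (by nlinarith)
      (fun i ↦ (Lorentz.gamma (V i))⁻¹) (fun i ↦ ‖V i‖) Rz (fun i ↦ inv_pos.mpr (hγV i))
      (fun i ↦ inv_le_one_of_one_le₀ (Lorentz.one_le_gamma (hV1 i)))
      (fun i h ↦ norm_eq_zero_of_inv_gamma_eq_one (hV1 i) h)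
      (1 + ∑ i, |rin i| + ∑ i, Kerr.rPlus (M i) 0)
  have hR'1 : ∀ t, 1 ≤ R' t := fun t ↦ by
    have h1 : 0 ≤ ∑ i, |rin i| := Finset.sum_nonneg fun i _ ↦ abs_nonneg _
    have h2 : 0 ≤ ∑ i, Kerr.rPlus (M i) 0 := Finset.sum_nonneg fun i _ ↦ (hrp0 i).le
    linarith [hR'0 t]
  have hR'rp : ∀ t j, Kerr.rPlus (M j) 0 < R' t := fun t j ↦ by
    have h1 : 0 ≤ ∑ i, |rin i| := Finset.sum_nonneg fun i _ ↦ abs_nonneg _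
    have h2 : Kerr.rPlus (M j) 0 ≤ ∑ i, Kerr.rPlus (M i) 0 :=
      Finset.single_le_sum (f := fun i ↦ Kerr.rPlus (M i) 0) (fun i _ ↦ (hrp0 i).le)
        (Finset.mem_univ j)
    linarith [hR'0 t]
  -- near-zone convergence along the meshed radii
  have hconvRi : ∀ i, Tendsto (fun τ ↦ 𝒟.toSpacetime.truncDeviationCk
      (boostedKerrBackground (Lorentz.boost (V i) (hV1 i)) 0 (M i) 0)
      (fun y ↦ Φ ⟨A i y.1, hAU i y.1 y.2⟩) 2 (R i τ) τ) atTop (𝓝 0) := fun i ↦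
    tendsto_of_tendsto_of_tendsto_of_le_of_le tendsto_const_nhds (hRdc i) (fun _ ↦ zero_le)
      fun τ ↦ 𝒟.toSpacetime.truncDeviationCk_mono _ _ 2 (hRle i τ) τ
  -- ### the flat package
  have hembs : IsOpenEmbedding (({x : U | τs < x.1 0} : Set U).restrict Φ) :=
    isOpenEmbedding_restrict_late_mono (le_max_left _ _) hembΦ
  obtain ⟨U₀, hU₀, ρexc, hU₀eq, hexc, htube, hflatdev, hflatemb⟩ :=
    flat_radiationZone_package_of_profile' 𝒟.toSpacetime M rin Λ ξ v τs U Φ hΦ hUs hembs (k := 2)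
      hdev hfut hvΛ hκ₀ hvs hv hξ hvb hξb V hV1 hces hR'c
      (fun t ↦ by
        have h2 : 0 ≤ ∑ i, Kerr.rPlus (M i) 0 := Finset.sum_nonneg fun i _ ↦ (hrp0 i).le
        linarith [hR'0 t]) hR't hR'd
  -- ### certified static reach per hole (`δ = 1`)
  have hstat0 : ∀ i, ∃ S : ℝ,
      ∀ (y : (boostedKerrBackground (Lorentz.boost (V i) (hV1 i)) 0 (M i) 0).domain) (τ₁ : ℝ),
      S ≤ (boostedKerrBackground (Lorentz.boost (V i) (hV1 i)) 0 (M i) 0).time y.1 →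
      (boostedKerrBackground (Lorentz.boost (V i) (hV1 i)) 0 (M i) 0).time y.1 ≤ τ₁ →
      Kerr.rPlus (M i) 0 + 1 ≤ (boostedKerrBackground (Lorentz.boost (V i) (hV1 i)) 0 (M i) 0).radius y.1 →
      (boostedKerrBackground (Lorentz.boost (V i) (hV1 i)) 0 (M i) 0).radius y.1 ≤
        R i ((boostedKerrBackground (Lorentz.boost (V i) (hV1 i)) 0 (M i) 0).time y.1) →
      Φ ⟨A i y.1, hAU i y.1 y.2⟩ ∈ 𝒟.metric.causalPast 𝒟.timeOrientation
        ((fun y : (boostedKerrBackground (Lorentz.boost (V i) (hV1 i)) 0 (M i) 0).domain ↦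
          Φ ⟨A i y.1, hAU i y.1 y.2⟩) ''
          (boostedKerrBackground (Lorentz.boost (V i) (hV1 i)) 0 (M i) 0).truncTimeSlab (R i τ₁) τ₁) :=
    fun i ↦ exists_static_reach_rechart U Φ hΦ (hM i) (hV1 i) (hA i) (hAU i) (hθ' i) (hDA i)
      (fun x ↦ TO < x.1 0 ∧ ∀ j, rin j < rp j x) (fun x hQ w ↦ hOfut x hQ.1 hQ.2 w) (hQA i)
      (R i) (hRm i) (hconvRi i) one_pos
  choose S hstat using hstat0
  -- ### thresholds
  set Tc : ℝ := 1 + ∑ i, |T i| + |Tm| with hTc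
  set Sa : ℝ := ∑ i, |S i| with hSa
  set τ₁₀ : ℝ := |τs| + 2 + Tc + |τT| + |Tm| + 2 * |Sa| * ∑ i, Lorentz.gamma (V i) + 1
    with hτ₁₀
  have hTcT : ∀ i, T i + 1 ≤ Tc := fun i ↦ by
    have : |T i| ≤ ∑ i, |T i| :=
      Finset.single_le_sum (f := fun i ↦ |T i|) (fun i _ ↦ abs_nonneg _) (Finset.mem_univ i)
    rw [hTc]; linarith [le_abs_self (T i), abs_nonneg Tm]
  have hTcm : Tm ≤ Tc := by rw [hTc]; linarith [le_abs_self Tm, Finset.sum_nonneg (fun i _ ↦ abs_nonneg (T i)) (s := Finset.univ)]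
  have hTc0 : 0 ≤ Tc := by rw [hTc]; linarith [abs_nonneg Tm, Finset.sum_nonneg (fun i _ ↦ abs_nonneg (T i)) (s := Finset.univ)]
  have hγsum : ∀ i, Lorentz.gamma (V i) ≤ ∑ i, Lorentz.gamma (V i) := fun i ↦
    Finset.single_le_sum (f := fun i ↦ Lorentz.gamma (V i)) (fun i _ ↦ (hγV i).le) (Finset.mem_univ i)
  have hτ₁₀ge : Tc ≤ τ₁₀ ∧ Tm ≤ τ₁₀ ∧ max τs 0 + 2 ≤ τ₁₀ ∧ τT < τ₁₀ ∧
      ∀ i, 2 * |Sa| * Lorentz.gamma (V i) ≤ τ₁₀ := by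
    have h2 : 0 ≤ ∑ i, Lorentz.gamma (V i) := Finset.sum_nonneg fun i _ ↦ (hγV i).le
    have h3 : 0 ≤ 2 * |Sa| * ∑ i, Lorentz.gamma (V i) := by positivity
    have h4 : max τs 0 ≤ |τs| := max_le (le_abs_self _) (abs_nonneg _)
    refine ⟨by rw [hτ₁₀]; linarith [abs_nonneg τs, abs_nonneg Tm, abs_nonneg τT], ?_,
      by rw [hτ₁₀]; linarith [abs_nonneg Tm, abs_nonneg τT], ?_, fun i ↦ ?_⟩
    · rw [hτ₁₀]; linarith [abs_nonneg τs, le_abs_self Tm, abs_nonneg τT]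
    · rw [hτ₁₀]; linarith [abs_nonneg τs, abs_nonneg Tm, le_abs_self τT]
    · have : 2 * |Sa| * Lorentz.gamma (V i) ≤ 2 * |Sa| * ∑ i, Lorentz.gamma (V i) :=
        mul_le_mul_of_nonneg_left (hγsum i) (by positivity)
      rw [hτ₁₀]; linarith [abs_nonneg τs, abs_nonneg Tm, abs_nonneg τT]
  obtain ⟨hτTc, hτTm, hτs2, hττT, hτS⟩ := hτ₁₀ge
  have hτ : τ₀ < τ₁₀ := by
    have : τ₀ ≤ max τs 0 := (le_max_left τ₀ TO).trans (le_max_left _ _)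
    linarith
  have hSi : ∀ i, S i ≤ Sa := fun i ↦ (le_abs_self _).trans
    (Finset.single_le_sum (f := fun i ↦ |S i|) (fun i _ ↦ abs_nonneg _) (Finset.mem_univ i))
  -- ### painted radius ≤ γ₀ × lab distance at honest late lab points
  have hrpw : ∀ i (x : U), T i + 1 ≤ x.1 0 → γ₀ * ‖E4.spatial x.1 - ξ i (x.1 0)‖ ≤ ρ i (x.1 0) / 2 →
      rp i x ≤ γ₀ * ‖E4.spatial x.1 - ξ i (x.1 0)‖ := fun i x hx0 hxρ ↦
    paintedRadius_le_gamma_mul_dist (hV1 i) (ξ i) (v i) (hv1 i) hκ₀ (hvs i) (Λ i) (hfut i) (hvΛ i)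
      (hcovA i) (hrad2 i) x.1 hx0 hxρ
  -- ### inputs of the transfer without loitering
  -- continuity of the painted radii; the late painted exterior image is open
  have hrpc : ∀ j, Continuous (rp j) := fun j ↦
    (continuous_paintedRadius 0 (Λ j) (ξ j) (hΛc j) (hξ j).continuous).comp continuous_subtype_val
  have hWo : IsOpen (Φ '' {x : U | τ₀ < x.1 0 ∧ Pext x}) :=
    isOpen_image_late_of_continuous hembΦ rp hrpc fun j ↦ Kerr.rPlus (M j) 0
  have hOcl : ∀ p ∈ O, ∀ z : 𝒟.carrier, z ∈ 𝒟.metric.causalFuture 𝒟.timeOrientation {p} →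
      z ∈ 𝒟.metric.causalPast 𝒟.timeOrientation (Φ '' {x : U | τ₀ < x.1 0 ∧ Pext x}) → z ∈ O :=
    fun p hp z hz hzW ↦ mem_exterior_of_causalFuture_of_causalPast 𝒟 hWo hO hp hz hzW
  -- injectivity of the lab chart on the late region
  have hinj : InjOn Φ {x : U | τ₀ < x.1 0} := by
    intro x hx y hy hxy
    have h := hembΦ.injective (a₁ := ⟨x, hx⟩) (a₂ := ⟨y, hy⟩) hxy
    exact congrArg Subtype.val h
  -- the bounds `Rz ≤ R' ≤ γ₀² R'`
  have hRzR' : ∀ i t, Rz i ≤ R' t := fun i t ↦ by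
    show Kerr.rPlus (M i) 0 + 1 ≤ _
    have := hR'0 t
    have h2 : Kerr.rPlus (M i) 0 ≤ ∑ i, Kerr.rPlus (M i) 0 :=
      Finset.single_le_sum (f := fun i ↦ Kerr.rPlus (M i) 0) (fun i _ ↦ (hrp0 i).le)
        (Finset.mem_univ i)
    have h3 : 0 ≤ ∑ i, |rin i| := Finset.sum_nonneg fun i _ ↦ abs_nonneg _
    linarith
  have hRz0 : ∀ i, 0 ≤ Rz i := fun i ↦ by show 0 ≤ Kerr.rPlus (M i) 0 + 1; linarith [hrp0 i]
  have hRzC : ∀ i t, Rz i ≤ γ₀ ^ 2 * R' t := fun i t ↦ (hRzR' i t).trans (by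
    have hγ2 : 1 ≤ γ₀ ^ 2 := one_le_pow₀ hγ₀1
    have h := mul_le_mul_of_nonneg_right hγ2 (zero_le_one.trans (hR'1 t))
    linarith)
  -- the inner model→lab dictionary
  have hlab : ∀ (i : Fin N) (y : (boostedKerrBackground (Lorentz.boost (V i) (hV1 i)) 0 (M i) 0).domain)
      (x : U), Φ x = Φ ⟨A i y.1, hAU i y.1 y.2⟩ → Tc ≤ x.1 0 →
      (boostedKerrBackground (Lorentz.boost (V i) (hV1 i)) 0 (M i) 0).radius y.1 < Rz i →
      rp i x = (boostedKerrBackground (Lorentz.boost (V i) (hV1 i)) 0 (M i) 0).radius y.1 := by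
    intro i y x hxy hxT hyr
    have hx0 : τ₀ < x.1 0 := by linarith [hTcT i, hτ0T i]
    have hxA : x = ⟨A i y.1, hAU i y.1 y.2⟩ := hinj hx0 ((hτ0T i).trans_lt (hAT i y.1)) hxy
    have hA0 : Tc ≤ A i y.1 0 := by rw [hxA] at hxT; exact hxT
    have hyT : T i + 1 ≤ y.1 0 :=
      le_of_le_apply_of_deriv_pos (hθ' i) (hθid i) (by rw [← hAθ i]; exact (hTcT i).trans hA0)
    have hy0 : A i y.1 0 = y.1 0 := by rw [hAθ i, hθid i _ hyT]
    have hyTm : Tm ≤ y.1 0 := by rw [← hy0]; exact hTcm.trans hA0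
    have hyρ : (boostedKerrBackground (Lorentz.boost (V i) (hV1 i)) 0 (M i) 0).radius y.1 ≤
        ρ i (y.1 0) / 2 := by
      obtain ⟨h1, -⟩ := hTm (y.1 0) hyTm i
      have := hRzC i (y.1 0)
      linarith
    obtain ⟨-, hrad, -⟩ := lab_of_model (hV1 i) (ξ i) (v i) (Λ i) (hfut i) (hvΛ i) (hrad2 i)
      (hAθ i) (hθid i) y hyT hyρ
    rw [hxA]
    exact hrad
  -- the threshold `T₂`
  set T₂ : ℝ → ℝ := fun τ ↦ (∑ i, Lorentz.gamma (V i)) * (|τ| + ∑ i, Rz i) + |τ| with hT₂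
  have hT₂' : ∀ (i : Fin N) (τ₁ : ℝ), (τ₁ + ‖V i‖ * Rz i) / (Lorentz.gamma (V i))⁻¹ ≤ T₂ τ₁ ∧
      τ₁ ≤ T₂ τ₁ := fun i τ₁ ↦
    affine_threshold_family (fun i ↦ Lorentz.gamma (V i)) (fun i ↦ ‖V i‖) Rz hγV
      (fun i ↦ (hV1 i).le) hRz0 i τ₁
  -- ### the transfer
  have htransfer := fun τ₁ (hτ₁ : τ₁₀ ≤ τ₁) ↦ exterior_subset_certified_union_causalPast₂ U Φ O Pext rp
    (fun j ↦ Kerr.rPlus (M j) 0) (fun _ ↦ (1 : ℝ)) Rz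
    (fun i ↦ boostedKerrBackground (Lorentz.boost (V i) (hV1 i)) 0 (M i) 0)
    (fun i y ↦ Φ ⟨A i y.1, hAU i y.1 y.2⟩) R hRm U₀ hU₀ (fun t ↦ γ₀ * R' t) T₂
    (fun i ↦ (Lorentz.gamma (V i))⁻¹) (fun i ↦ ‖V i‖) (τ₀ := τ₀) (τ₀' := τ₁₀) (τT := τT) (Tc := Tc)
    (S := Sa) hτ hττT hτTc (fun i ↦ norm_nonneg _) (fun i ↦ inv_pos.mpr (hγV i)) hexh
    (fun x x' hx hxP hx' hx'P hJ ↦ hT x x' ⟨hx, fun j ↦ (hrin j).trans (hxP j)⟩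
      ⟨hx', fun j ↦ (hrin j).trans (hx'P j)⟩ hJ)
    hOcl himO hembΦ hrpc
    (fun i ↦ isOpenEmbedding_rechart U Φ (hV1 i) (hAemb i) (hAU i) (hAT i) (hτ0T i) hembΦ)
    (fun i ↦ continuous_kb_boosted_time (hV1 i) (M i))
    (fun i ↦ (Kerr.continuous_radius 0).comp (continuous_poincareInv _ _))
    hlab
    (by
      -- hsplit
      intro x hx hxP
      by_cases hxU : x.1 ∈ (U₀ : Set E4)
      · exact Or.inl hxU
      · right
        rw [hU₀eq] at hxU
        simp only [Set.mem_setOf_eq, not_and, not_forall, not_lt] at hxU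
        obtain ⟨i, hi⟩ := hxU (by linarith [le_max_left τs 0, le_max_right τs 0])
        refine ⟨i, ?_⟩
        have hxT : T i + 1 ≤ x.1 0 := (hTcT i).trans (hτTc.trans hx)
        have hmesh1 := (hTm (x.1 0) (hτTm.trans hx) i).1
        have hγw : γ₀ * ‖E4.spatial x.1 - ξ i (x.1 0)‖ ≤ ρ i (x.1 0) / 2 := by
          have : γ₀ * ‖E4.spatial x.1 - ξ i (x.1 0)‖ ≤ γ₀ * R' (x.1 0) :=
            mul_le_mul_of_nonneg_left hi (zero_le_one.trans hγ₀1)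
          have hRb : γ₀ * R' (x.1 0) * 1 ≤ γ₀ * R' (x.1 0) * γ₀ :=
            mul_le_mul_of_nonneg_left hγ₀1
              (mul_nonneg (zero_le_one.trans hγ₀1) (zero_le_one.trans (hR'1 _)))
          nlinarith [hR'1 (x.1 0)]
        exact (hrpw i x hxT hγw).trans (mul_le_mul_of_nonneg_left hi (zero_le_one.trans hγ₀1)))
    (fun x j hx ↦ hx j)
    (by
      -- hcov
      intro i x hx hxr hxb
      refine exists_model_of_lab U Φ (hM i) (hV1 i) (ξ i) (v i) (hv1 i) hκ₀ (hvs i) (Λ i) (hfut i)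
        (hvΛ i) (hAU i) (hcovA i) (hrad2 i) x ((hTcT i).trans hx) hxr ?_
      have hmesh1 := (hTm (x.1 0) (hTcm.trans hx) i).1
      have : γ₀ * rp i x ≤ γ₀ * (γ₀ * R' (x.1 0)) := mul_le_mul_of_nonneg_left hxb (zero_le_one.trans hγ₀1)
      nlinarith)
    (fun i t _ ↦ (hRzR' i t).trans (by
      have h := mul_le_mul_of_nonneg_right hγ₀1 (zero_le_one.trans (hR'1 t))
      linarith))
    (fun i ↦ le_rfl)
    hT₂'
    (fun i y τ₁ _ hyS hy₁ hyr hyR ↦ hstat i y τ₁ ((hSi i).trans hyS) hy₁ hyr hyR)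
    (by
      -- hmesh
      intro i t ht
      obtain ⟨-, h2, h3, h4, -⟩ := hTm t (hτTm.trans ht) i
      have hR'0' : 0 ≤ R' t := zero_le_one.trans (hR'1 t)
      have hβ0 : 0 ≤ ‖V i‖ := norm_nonneg _
      have hRb : γ₀ * R' t ≤ γ₀ ^ 2 * R' t := by
        have h := mul_le_mul_of_nonneg_left hγ₀1 (mul_nonneg (zero_le_one.trans hγ₀1) hR'0')
        nlinarith [h]
      have hβRb : ‖V i‖ * (γ₀ * R' t) ≤ (Lorentz.gamma (V i))⁻¹ * t / 2 := by nlinarith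
      have hS2 : Sa ≤ (Lorentz.gamma (V i))⁻¹ * t / 2 := by
        have h5 : 2 * |Sa| * Lorentz.gamma (V i) ≤ t := (hτS i).trans ht
        have hγ := hγV i
        have h6 : |Sa| ≤ (Lorentz.gamma (V i))⁻¹ * t / 2 := by
          rw [show (Lorentz.gamma (V i))⁻¹ * t / 2 = t / (2 * Lorentz.gamma (V i)) by
            field_simp, le_div_iff₀ (by positivity)]
          linarith
        exact (le_abs_self Sa).trans h6
      refine ⟨by linarith, ?_, by nlinarith⟩
      exact hRb.trans (h2.trans (hRm i (by linarith))))
    (by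
      -- hzone
      intro i t ht
      obtain ⟨-, -, h3, -, h5⟩ := hTm t (hτTm.trans ht) i
      have hβRz : ‖V i‖ * Rz i ≤ (Lorentz.gamma (V i))⁻¹ * t / 2 := by
        have h6 := mul_le_mul_of_nonneg_left (hRzC i t) (norm_nonneg (V i))
        have h7 : ‖V i‖ * (γ₀ ^ 2 * R' t) = ‖V i‖ * γ₀ ^ 2 * R' t := by ring
        linarith
      have hS2 : Sa ≤ (Lorentz.gamma (V i))⁻¹ * t / 2 :=
        le_half_of_two_mul_le_rechart (hγV i) ((hτS i).trans ht)
      have ht0 : 0 ≤ t := by linarith [le_max_right τs 0]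
      have hαt : (Lorentz.gamma (V i))⁻¹ * t / 2 ≤ t := by
        have : (Lorentz.gamma (V i))⁻¹ * t ≤ 1 * t :=
          mul_le_mul_of_nonneg_right (inv_le_one_of_one_le₀ (Lorentz.one_le_gamma (hV1 i))) ht0
        linarith
      refine ⟨by linarith, h5.trans (hRm i (by linarith)), h5.trans (hRm i hαt)⟩)
    τ₁ hτ₁
  -- ### pairwise disjointness
  have hdisj := exists_pairwise_disjoint_truncLateRegion M ξ v hv1 V hV1 U Φ hinj A T ρ hAU
    (fun i x ↦ (hτ0T i).trans_lt (hAT i x)) hρt hhon hsep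
  -- ### assembly
  have hflatemb' : IsOpenEmbedding (((Minkowski.backgroundOn U₀).lateRegion τ₁₀).restrict
      (Φ ∘ Opens.inclusion hU₀)) :=
    isOpenEmbedding_restrict_late_mono (W := U₀) (by linarith) hflatemb
  refine exists_finalStateDecomposition_of_rechart 𝒟 M hM V hV1 U Φ hΦ O Pext hτ hO himO A hA hAU
    (fun i y ↦ ⟨(hτ0T i).trans_lt (hAT i y.1), hPextA i y⟩)
    (fun i ↦ isOpenEmbedding_rechart U Φ (hV1 i) (hAemb i) (hAU i) (hAT i) (hτ0T i) hembΦ)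
    hconvR R hconvRi hdisj U₀ hU₀ ρexc hexc (fun x hx ↦ htube ⟨by linarith [hx.1], hx.2⟩) hflatdev
    hflatemb' (fun x hx j ↦ ?_) htransfer
  -- flat late points lie outside every painted horizon
  have hxU : (x.1 : E4) ∈ (U₀ : Set E4) := x.2
  rw [hU₀eq] at hxU
  exact (hR'rp _ j).trans (hxU.2 j |>.trans_le (norm_sub_centre_le_paintedRadius (ξ j) (Λ j) x.1))

end Assembly

end Summit.FinalStateConjecture.FinalStateConjecture.Theorems
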